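import Summits.QuantumFields.YangMills.Theorems.BalabanUVNodesN21HistoriesWindowedModelADefs
import Summits.QuantumFields.YangMills.Theorems.BalabanUVNodesN21SourceTiltAtRecordLedgers
import Summits.QuantumFields.YangMills.Theorems.BalabanUVNodesN21SourceTiltJointSpace

/-!
# YM-DAG node N21 (= NE7c) — ROW A⁵ «CLOSENESS IS CONDITIONAL»: module 20e's last displayed a.e. species `hcloseX` (two-run closeness `ν^X_τ`-a.e. UNCONDITIONALLY) weakened to
# closeness ON THE HISTORY's OWN SMALL EVENT at no cost in constants — the leaf's letters are BLIND off that event; the junction PROVED; the N16 junction made DETERMINISTIC +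
# GEOMETRIC; and the at-record ∕ joint-space twins of modules 23b ∕ 23c with the conditional species — the lens's `Sketch-nearmiss-g7.lean` §A (blindness half) ∕ §B ∕ Cards 19
# VERBATIM + this seat's §3

Track A of `YM-PLAN.md` (cell `pub-ymgap`, HUMAN RULING D-0062), node **N21**; R134 fan-out seat `pub-ymgap-dag-n21-d` (s2), generation 6, module 20g.  THEOREMS ONLY: 0 `def`,
0 `sorry`, standard axioms; COUNT-NEUTRAL; KEY-FREE; `--supports` the K3⁗ item `SpineGivenEndpointR13Sep` (stmt-QuantumFields-20292) as a helper.  NO Theses import, NO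
`Node00.Record13` import.  §1 ∕ §2 ∕ §2′ ARE the planner seat `ym-lens-BalabanUVNodes-nearmiss` g7's farm-checked sketch `Sketch-nearmiss-g7.lean` (sha16 326ceaa2d7da4764) §A
(blindness theorems) ∕ §B ∕ §C Card 19 (`condClose_of_domainClose`, `condClose_modelAW`) VERBATIM (namespace renamed; CREDIT: ym-lens-BalabanUVNodes-nearmiss g7, memo `LENS-nearmiss.md`
v7.0 8713c929b71745b4, Cards 17 ∕ 19, FAN-OUT ROW A⁵); §3 is this seat's.  Imports module 20h `BalabanUVNodesN21HistoriesWindowedModelADefs` (`smallEvent`, `smallProd_eq_zero_of_not_mem`,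
`measurableSet_smallEvent`, `liveSmallW`, `modelAWeightW`, `ae_uvSmall_modelAW`, `liveSmall`), module 23b `BalabanUVNodesN21SourceTiltAtRecordLedgers` (p503194; brings 20e
`levelLedgers_histories_of_resummation` ∕ `shellWeightBound_histories_of_resummation` and module 23 `dressedLaw_sandwich_map` ∕ `isFiniteMeasure_boltzmannLaw`) and module 23c
`BalabanUVNodesN21SourceTiltJointSpace` (`sourceTiltThrough_sandwich`).

THE POINT (lens Card 17).  The leaf's four letters `histWeight ∕ histShell ∕ histPiece ∕ histLaw` — hence (RESUM) too — are BLIND under `ν_τ ↦ ν_τ|E_τ`, `E_τ = smallEvent (small K τ)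
u^X (a ∘ lvl)` (§1), so module 20e holds VERBATIM with `hcloseX` weakened to «`∀ᵐ ω ∂ν^X_τ, (∀ s' ∈ small K τ, u^X_{s'} ω < a_{lvl s'}) → ∣u^X_s ω − u^Y_s ω∣ ≤ Δ_{lvl s}`» (§2:
ONE CALL of 20e at the restricted weights; SAME constants).  §2′ (lens Card 19): that conditional closeness follows, for the windowed model-A weights of module 20h, from exactly two
non-law inputs — N16's POINTWISE implication at NOMINAL thresholds `hdet : (∀ c ∈ nbhd s, u^A_c ω < θ_c) → ∣u^A_s ω − u^B_s ω∣ ≤ Δ_s` and NODE O's geometry `hgeom : nbhd s ⊆ liveSmall τ`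
(causal liveness) — for every selected `a ≤ θ` (`condClose_of_domainClose`, `condClose_modelAW`); NO measure, NO a.e., NO coupling in N16's contract.  §3 (this seat): the at-record
twin of module 23b and the joint-space twin of module 23c with the CONDITIONAL species — `shellWeightBound_histories_of_condCloseness_atRecord` (γ's := the Boltzmann ∕ dressed laws of
`D.scheme g₀` pushed along NODE O's embeddings, `M := e^{l₀}`) and `shellWeightBound_histories_of_condCloseness_through` (γt := any t-free law tilted through the level-0 projection).

HONEST FRAMING (binding).  DISPLAYED after this file on the histories road, per run: (RESUM) `hresX` — a THEOREM of the windowed constructor (20h `sum_histLaw_modelAW`) once NODE O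
delivers its family in that shape; CONDITIONAL closeness `hcloseX'` — from N16's pointwise `hdet` + NODE O's `hgeom` + the box by `condClose_modelAW`; `hwin` (N20); `hΔ`; the box; the
rate; `AvgMeasurable` (the bounded source is module 23's theorem).  [folklore] measure theory (`Measure.restrict`, `withDensity`, `ae_restrict_iff'`); nothing of Bałaban's asserted;
(M1) at print's FIXED thresholds untouched; NE7c is NOT PRINTED and NOT PROVED; **N21 is NOT discharged**; K3⁗ NOT claimed; typed 28∕28, discharged count untouched; one finite four-torus
programme at fixed `ε` — NOT ℝ⁴, NOT infinite volume, NOT OS, NOT a mass gap, NOT Clay.  No decl below carries a cite tag.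
-/

set_option autoImplicit false

noncomputable section

open scoped BigOperators ENNReal
open MeasureTheory Set

namespace Summit.QuantumFields.YangMills.Theorems.N21HistoriesConditionalCloseness

open Literature.MathematicalPhysics.QuantumFieldTheory.Balaban1983to89
open Literature.MathematicalPhysics.QuantumFieldTheory.Balaban1983to89.T4Continuum (T4Family ULoop FiniteEpsData)
open Literature.MathematicalPhysics.QuantumFieldTheory.Balaban1983to89.T4IndicatorShell (smallInd ShellWeightBound)
open T4GenFunBounds (prodObs)
open Missing (boltzmann)
open T4ShellMeasureLevels (LevelLedger LiveWindow)
open Summit.QuantumFields.BalabanUV.T4Continuum.ShellMeasureRootCompositionHistories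
  (smallProd smallProd_nonneg measurable_smallProd histWeight histShell histPiece histLaw)
open Summit.QuantumFields.YangMills.Theorems.N21SelectedThresholdsHistoriesResummation
  (levelLedgers_histories_of_resummation shellWeightBound_histories_of_resummation)
open Summit.QuantumFields.YangMills.Theorems.N21HistoriesModelADefs (liveSmall)
open Summit.QuantumFields.YangMills.Theorems.N21HistoriesWindowedModelADefs
  (smallEvent smallProd_eq_zero_of_not_mem measurableSet_smallEvent liveSmallW modelAWeightW ae_uvSmall_modelAW)
open Summit.QuantumFields.YangMills.Theorems.N21SourceTiltAtRecord (dressedLaw_sandwich_map isFiniteMeasure_boltzmannLaw)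
open Summit.QuantumFields.YangMills.Theorems.N21SourceTiltJointSpace (sourceTiltThrough_sandwich)

/-! ## §1 blindness: the letters do not see the weight off the history's own small event (lens Sketch-g7 §A, VERBATIM) -/

section Blind

variable {Ω σ : Type*} [MeasurableSpace Ω] [DecidableEq σ]

omit [DecidableEq σ] in
/-- **BLINDNESS OF THE WEIGHT**: `histWeight (ν|E) = histWeight ν`. [folklore] -/
theorem histWeight_restrict (ν : Measure Ω) (sm : Finset σ) (u : σ → Ω → ℝ) (ϑ : σ → ℝ) :
    histWeight (ν.restrict (smallEvent sm u ϑ)) sm u ϑ = histWeight ν sm u ϑ :=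
  setIntegral_eq_integral_of_forall_compl_eq_zero fun _ hω => smallProd_eq_zero_of_not_mem hω

omit [DecidableEq σ] in
/-- **BLINDNESS OF THE SHELL PART** (run X's shell part, restricted by run X's own small event). [folklore] -/
theorem histShell_restrict (ν : Measure Ω) (sm : Finset σ) (uA uB : σ → Ω → ℝ) (ϑ : σ → ℝ) :
    histShell (ν.restrict (smallEvent sm uA ϑ)) sm uA uB ϑ = histShell ν sm uA uB ϑ :=
  setIntegral_eq_integral_of_forall_compl_eq_zero fun ω hω => by
    rw [smallProd_eq_zero_of_not_mem hω, zero_mul]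

/-- **BLINDNESS OF THE PIECES**. [folklore] -/
theorem histPiece_restrict (ν : Measure Ω) (sm : Finset σ) (uA uB : σ → Ω → ℝ) (ϑ : σ → ℝ) (s : σ) :
    histPiece (ν.restrict (smallEvent sm uA ϑ)) sm uA uB ϑ s = histPiece ν sm uA uB ϑ s := by
  unfold histPiece
  split_ifs with hs
  · exact setIntegral_eq_integral_of_forall_compl_eq_zero fun ω hω => by
      rw [smallProd_eq_zero_of_not_mem hω, zero_mul]
  · rfl

omit [DecidableEq σ] in
/-- **BLINDNESS OF THE LAW**: `histLaw (ν|E) = histLaw ν` (the density `smallProd` vanishes off `E`). [folklore] -/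
theorem histLaw_restrict (ν : Measure Ω) (sm : Finset σ) {u : σ → Ω → ℝ} (hu : ∀ s, Measurable (u s)) (ϑ : σ → ℝ) :
    histLaw (ν.restrict (smallEvent sm u ϑ)) sm u ϑ = histLaw ν sm u ϑ := by
  unfold histLaw
  rw [← withDensity_indicator (measurableSet_smallEvent sm hu ϑ)]
  refine congrArg _ (funext fun ω => ?_)
  by_cases h : ω ∈ smallEvent sm u ϑ
  · exact indicator_of_mem h _
  · rw [indicator_of_notMem h, smallProd_eq_zero_of_not_mem h, ENNReal.ofReal_zero]

omit [DecidableEq σ] in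
/-- **CONDITIONAL CLOSENESS IS A.E. CLOSENESS UNDER THE RESTRICTED WEIGHT** (`ae_restrict_iff'`). [folklore] -/
theorem ae_restrict_smallEvent_iff (ν : Measure Ω) (sm : Finset σ) {u : σ → Ω → ℝ} (hu : ∀ s, Measurable (u s)) (ϑ : σ → ℝ)
    {p : Ω → Prop} : (∀ᵐ ω ∂(ν.restrict (smallEvent sm u ϑ)), p ω) ↔ ∀ᵐ ω ∂ν, (∀ s ∈ sm, u s ω < ϑ s) → p ω :=
  ae_restrict_iff' (measurableSet_smallEvent sm hu ϑ)

end Blind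

/-! ## §2 the junction: module 20e with CONDITIONAL closeness (lens Sketch-g7 §B, VERBATIM) -/

section Junction

variable {Ω : ℕ → Type*} [∀ K, MeasurableSpace (Ω K)] {σ ι : Type*} [DecidableEq σ]
  {T : ℕ → Finset ι} {C : ℕ → Finset σ} {small : ℕ → ι → Finset σ} {lvl : ℕ → σ → ℕ}
  {νA νB : ∀ K : ℕ, (ℕ → ℝ) → ℝ → ι → Measure (Ω K)} [∀ K a t τ, IsFiniteMeasure (νA K a t τ)] [∀ K a t τ, IsFiniteMeasure (νB K a t τ)]
  {γ0A γ0B : ∀ K : ℕ, Measure (Ω K)} [∀ K, IsFiniteMeasure (γ0A K)] [∀ K, IsFiniteMeasure (γ0B K)]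
  {γtA γtB : ∀ K : ℕ, ℝ → Measure (Ω K)}
  {uA uB : ∀ K : ℕ, σ → Ω K → ℝ} {θ κ ρ Δ : ℕ → ℝ} {l₀ M νbar : ℝ}

/-- **BOTH RUNS' HISTORY LEDGERS FROM RESUMMATION, CLOSENESS ONLY ON THE OWN SMALL EVENT.**  Module 20e's
`levelLedgers_histories_of_resummation` with its binder `hcloseX` (ν^X_τ-a.e. closeness, unconditionally) REPLACED by the weaker
`hcloseX'`: ν^X_τ-a.e. `ω`, IF every live-small slot `s'` of the history is small in run X at `ω` (`u^X_{s'} ω < a (lvl K s')`) THEN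
`|u^X_s ω − u^Y_s ω| ≤ Δ (lvl K s)` — which is all the leaf's piece integrand `smallProd^X_τ · (1 − χ(u^Y_s))` ever uses.  Proof: 20e at the
restricted weights `ν^X_τ|{own small event}`; blindness §A. [folklore] -/
theorem levelLedgers_histories_of_condCloseness
    (huA : ∀ K s, Measurable (uA K s)) (huB : ∀ K s, Measurable (uB K s))
    (hsmall : ∀ K, ∀ τ ∈ T K, small K τ ⊆ C K)
    (hθ : ∀ j, 0 < θ j) (hκ : ∀ j, 0 < κ j ∧ κ j ≤ 1) (hρ : ∀ j, 0 ≤ ρ j ∧ ρ j < 1)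
    (hcount : ∀ K m, ((((C K).filter fun s => lvl K s = m).card : ℕ) : ℝ) ≤ νbar)
    (hle : ∀ K, ∀ s ∈ C K, lvl K s ≤ K) (hM : 0 < M)
    (hΔ : ∀ j, Δ j ≤ ρ j * ((1 - κ j) * θ j))
    (hcloseA : ∀ (K : ℕ) (a : ℕ → ℝ), (∀ j, a j ∈ Icc ((1 - κ j) * θ j) (θ j)) → ∀ t, |t| ≤ l₀ → ∀ τ ∈ T K, ∀ s ∈ small K τ,
      ∀ᵐ ω ∂(νA K a t τ), (∀ s' ∈ small K τ, uA K s' ω < a (lvl K s')) → |uA K s ω - uB K s ω| ≤ Δ (lvl K s))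
    (hcloseB : ∀ (K : ℕ) (a : ℕ → ℝ), (∀ j, a j ∈ Icc ((1 - κ j) * θ j) (θ j)) → ∀ t, |t| ≤ l₀ → ∀ τ ∈ T K, ∀ s ∈ small K τ,
      ∀ᵐ ω ∂(νB K a t τ), (∀ s' ∈ small K τ, uB K s' ω < a (lvl K s')) → |uB K s ω - uA K s ω| ≤ Δ (lvl K s))
    (htiltA : ∀ K t, |t| ≤ l₀ → γtA K t ≤ ENNReal.ofReal M • γ0A K ∧ γ0A K ≤ ENNReal.ofReal M • γtA K t)
    (htiltB : ∀ K t, |t| ≤ l₀ → γtB K t ≤ ENNReal.ofReal M • γ0B K ∧ γ0B K ≤ ENNReal.ofReal M • γtB K t)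
    (hresA : ∀ (K : ℕ) (a : ℕ → ℝ), (∀ j, a j ∈ Icc ((1 - κ j) * θ j) (θ j)) → ∀ t, |t| ≤ l₀ →
      ∑ τ ∈ T K, histLaw (νA K a t τ) (small K τ) (uA K) (fun s => a (lvl K s)) = γtA K t)
    (hresB : ∀ (K : ℕ) (a : ℕ → ℝ), (∀ j, a j ∈ Icc ((1 - κ j) * θ j) (θ j)) → ∀ t, |t| ≤ l₀ →
      ∑ τ ∈ T K, histLaw (νB K a t τ) (small K τ) (uB K) (fun s => a (lvl K s)) = γtB K t) :
    ∃ a : ℕ → ℕ → ℝ, (∀ K j, a K j ∈ Icc ((1 - κ j) * θ j) (θ j)) ∧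
      LevelLedger l₀ T (fun K t τ => histWeight (νA K (a K) t τ) (small K τ) (uA K) (fun s => a K (lvl K s)))
        (fun K t τ => histShell (νA K (a K) t τ) (small K τ) (uA K) (uB K) (fun s => a K (lvl K s))) C
        (fun K t s τ => histPiece (νA K (a K) t τ) (small K τ) (uA K) (uB K) (fun s => a K (lvl K s)) s) lvl
        (fun j => M / M⁻¹ * (2 * νbar / ((1 - ρ j) * κ j))) ρ ∧
      LevelLedger l₀ T (fun K t τ => histWeight (νB K (a K) t τ) (small K τ) (uB K) (fun s => a K (lvl K s)))
        (fun K t τ => histShell (νB K (a K) t τ) (small K τ) (uB K) (uA K) (fun s => a K (lvl K s))) C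
        (fun K t s τ => histPiece (νB K (a K) t τ) (small K τ) (uB K) (uA K) (fun s => a K (lvl K s)) s) lvl
        (fun j => M / M⁻¹ * (2 * νbar / ((1 - ρ j) * κ j))) ρ := by
  have key := levelLedgers_histories_of_resummation (T := T) (C := C) (small := small) (lvl := lvl)
    (νA := fun K a t τ => (νA K a t τ).restrict (smallEvent (small K τ) (uA K) fun s => a (lvl K s)))
    (νB := fun K a t τ => (νB K a t τ).restrict (smallEvent (small K τ) (uB K) fun s => a (lvl K s)))
    (γ0A := γ0A) (γ0B := γ0B) (γtA := γtA) (γtB := γtB) (θ := θ) (κ := κ) (ρ := ρ) (Δ := Δ) (l₀ := l₀) (M := M) (νbar := νbar)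
    huA huB hsmall hθ hκ hρ hcount hle hM hΔ
    (fun K a ha t ht τ hτ s hs => (ae_restrict_smallEvent_iff _ _ (huA K) _).2 (hcloseA K a ha t ht τ hτ s hs))
    (fun K a ha t ht τ hτ s hs => (ae_restrict_smallEvent_iff _ _ (huB K) _).2 (hcloseB K a ha t ht τ hτ s hs))
    htiltA htiltB
    (fun K a ha t ht => (Finset.sum_congr rfl fun τ _ => histLaw_restrict _ _ (huA K) _).trans (hresA K a ha t ht))
    (fun K a ha t ht => (Finset.sum_congr rfl fun τ _ => histLaw_restrict _ _ (huB K) _).trans (hresB K a ha t ht))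
  simpa only [histWeight_restrict, histShell_restrict, histPiece_restrict] using key

/-- **N21's ROAD I ON HISTORY FAMILIES, CLOSENESS ONLY ON THE OWN SMALL EVENT.**  Module 20e's `shellWeightBound_histories_of_resummation` with
`hcloseX` replaced by the conditional `hcloseX'` of `levelLedgers_histories_of_condCloseness`; same constant `C′·ϑ^K`. [folklore] -/
theorem shellWeightBound_histories_of_condCloseness {N₁ : ℕ} {κmin c₁ ϑ : ℝ}
    (huA : ∀ K s, Measurable (uA K s)) (huB : ∀ K s, Measurable (uB K s))
    (hsmall : ∀ K, ∀ τ ∈ T K, small K τ ⊆ C K)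
    (hθ : ∀ j, 0 < θ j) (hκ : ∀ j, 0 < κ j ∧ κ j ≤ 1) (hρ : ∀ j, 0 ≤ ρ j ∧ ρ j < 1)
    (hwin : LiveWindow C lvl N₁ νbar) (hM : 0 < M)
    (hΔ : ∀ j, Δ j ≤ ρ j * ((1 - κ j) * θ j))
    (hcloseA : ∀ (K : ℕ) (a : ℕ → ℝ), (∀ j, a j ∈ Icc ((1 - κ j) * θ j) (θ j)) → ∀ t, |t| ≤ l₀ → ∀ τ ∈ T K, ∀ s ∈ small K τ,
      ∀ᵐ ω ∂(νA K a t τ), (∀ s' ∈ small K τ, uA K s' ω < a (lvl K s')) → |uA K s ω - uB K s ω| ≤ Δ (lvl K s))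
    (hcloseB : ∀ (K : ℕ) (a : ℕ → ℝ), (∀ j, a j ∈ Icc ((1 - κ j) * θ j) (θ j)) → ∀ t, |t| ≤ l₀ → ∀ τ ∈ T K, ∀ s ∈ small K τ,
      ∀ᵐ ω ∂(νB K a t τ), (∀ s' ∈ small K τ, uB K s' ω < a (lvl K s')) → |uB K s ω - uA K s ω| ≤ Δ (lvl K s))
    (htiltA : ∀ K t, |t| ≤ l₀ → γtA K t ≤ ENNReal.ofReal M • γ0A K ∧ γ0A K ≤ ENNReal.ofReal M • γtA K t)
    (htiltB : ∀ K t, |t| ≤ l₀ → γtB K t ≤ ENNReal.ofReal M • γ0B K ∧ γ0B K ≤ ENNReal.ofReal M • γtB K t)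
    (hresA : ∀ (K : ℕ) (a : ℕ → ℝ), (∀ j, a j ∈ Icc ((1 - κ j) * θ j) (θ j)) → ∀ t, |t| ≤ l₀ →
      ∑ τ ∈ T K, histLaw (νA K a t τ) (small K τ) (uA K) (fun s => a (lvl K s)) = γtA K t)
    (hresB : ∀ (K : ℕ) (a : ℕ → ℝ), (∀ j, a j ∈ Icc ((1 - κ j) * θ j) (θ j)) → ∀ t, |t| ≤ l₀ →
      ∑ τ ∈ T K, histLaw (νB K a t τ) (small K τ) (uB K) (fun s => a (lvl K s)) = γtB K t)
    (hκmin : 0 < κmin) (hκminle : ∀ j, κmin ≤ κ j) (hρhalf : ∀ j, ρ j ≤ 1 / 2)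
    (hϑ0 : 0 < ϑ) (hϑ1 : ϑ < 1) (hrate : ∀ j, ρ j ≤ c₁ * ϑ ^ j) :
    ∃ a : ℕ → ℕ → ℝ, (∀ K j, a K j ∈ Icc ((1 - κ j) * θ j) (θ j)) ∧
      ShellWeightBound l₀ T (fun K t τ => histWeight (νA K (a K) t τ) (small K τ) (uA K) (fun s => a K (lvl K s)))
        (fun K t τ => histWeight (νB K (a K) t τ) (small K τ) (uB K) (fun s => a K (lvl K s)))
        (fun K t τ => histShell (νA K (a K) t τ) (small K τ) (uA K) (uB K) (fun s => a K (lvl K s)))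
        (fun K t τ => histShell (νB K (a K) t τ) (small K τ) (uB K) (uA K) (fun s => a K (lvl K s)))
        fun K => (2 * ((N₁ + 1) * νbar * (M / M⁻¹ * (2 * (2 * νbar) / κmin)) * c₁ * ϑ⁻¹ ^ N₁)) * ϑ ^ K := by
  have key := shellWeightBound_histories_of_resummation (T := T) (C := C) (small := small) (lvl := lvl)
    (νA := fun K a t τ => (νA K a t τ).restrict (smallEvent (small K τ) (uA K) fun s => a (lvl K s)))
    (νB := fun K a t τ => (νB K a t τ).restrict (smallEvent (small K τ) (uB K) fun s => a (lvl K s)))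
    (γ0A := γ0A) (γ0B := γ0B) (γtA := γtA) (γtB := γtB) (θ := θ) (κ := κ) (ρ := ρ) (Δ := Δ) (l₀ := l₀) (M := M) (νbar := νbar)
    huA huB hsmall hθ hκ hρ hwin hM hΔ
    (fun K a ha t ht τ hτ s hs => (ae_restrict_smallEvent_iff _ _ (huA K) _).2 (hcloseA K a ha t ht τ hτ s hs))
    (fun K a ha t ht τ hτ s hs => (ae_restrict_smallEvent_iff _ _ (huB K) _).2 (hcloseB K a ha t ht τ hτ s hs))
    htiltA htiltB
    (fun K a ha t ht => (Finset.sum_congr rfl fun τ _ => histLaw_restrict _ _ (huA K) _).trans (hresA K a ha t ht))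
    (fun K a ha t ht => (Finset.sum_congr rfl fun τ _ => histLaw_restrict _ _ (huB K) _).trans (hresB K a ha t ht))
    hκmin hκminle hρhalf hϑ0 hϑ1 hrate
  simpa only [histWeight_restrict, histShell_restrict] using key

end Junction

/-! ## §2′ the N16 junction is deterministic + geometric (lens Sketch-g7 Card 19, VERBATIM) -/

section Geometry

variable {Ω σ : Type*} [MeasurableSpace Ω] [DecidableEq σ]

/-- **CARD 19 — THE N16 JUNCTION IS DETERMINISTIC + GEOMETRIC.**  If (N16-det) closeness at a live-small window slot `s` holds at EVERY `ω`
at which all slots of a neighbourhood `nbhd s` pass their small-field tests at the NOMINAL thresholds `θ`; (geometry of NODE O's term object,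
causal liveness) `nbhd s ⊆ smAll` = all live-small slots of the history, with the window slots `sm ⊆ smAll`; (§C) `ν`-a.e. every live-small slot
outside the window is small at `a`; and the selected thresholds are admissible (`a ≤ θ`): THEN §B's conditional closeness holds. [folklore] -/
theorem condClose_of_domainClose (ν : Measure Ω) {sm smAll : Finset σ} (nbhd : σ → Finset σ) {uA uB : σ → Ω → ℝ}
    {a θ Δ : σ → ℝ}
    (hdet : ∀ s ∈ sm, ∀ ω, (∀ c ∈ nbhd s, uA c ω < θ c) → |uA s ω - uB s ω| ≤ Δ s)
    (hgeom : ∀ s ∈ sm, nbhd s ⊆ smAll) (haθ : ∀ c, a c ≤ θ c)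
    (hae : ∀ᵐ ω ∂ν, ∀ c ∈ smAll, c ∉ sm → uA c ω < a c) :
    ∀ s ∈ sm, ∀ᵐ ω ∂ν, (∀ c ∈ sm, uA c ω < a c) → |uA s ω - uB s ω| ≤ Δ s := by
  intro s hs
  filter_upwards [hae] with ω hω hsmall
  refine hdet s hs ω fun c hc => ?_
  by_cases hcm : c ∈ sm
  · exact lt_of_lt_of_le (hsmall c hcm) (haθ c)
  · exact lt_of_lt_of_le (hω c (hgeom s hs hc) hcm) (haθ c)

end Geometry

section JunctionW

variable {Ω : Type*} [MeasurableSpace Ω] {n : ℕ}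

/-- **CARDS 18 + 19 AT ONE COMPARISON AND ONE HISTORY**: for the windowed model-A weight `ν_τ = restFactorW_τ · γ` of run A, §B's conditional
closeness at every live-small WINDOW slot `s` follows from exactly two non-law inputs — (N16-det) deterministic closeness at `s` whenever the
slots of `nbhd s` pass their tests at the NOMINAL thresholds `θ`, and (geometry, causal liveness) `nbhd s ⊆ liveSmall τ` — for every selected
`a ≤ θ`; the UV live-small slots are small ν_τ-a.e. by `ae_uvSmall_modelAW`. [folklore] -/
theorem condClose_modelAW (γ : Measure Ω) (W : Finset (Fin n)) (live : (Fin n → Bool) → Fin n → Bool) (τ : Fin n → Bool)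
    {uA uB : Fin n → Ω → ℝ} (huA : ∀ i, Measurable (uA i)) {a θ Δ : Fin n → ℝ} (nbhd : Fin n → Finset (Fin n))
    (hdet : ∀ s ∈ liveSmallW W live τ, ∀ ω, (∀ c ∈ nbhd s, uA c ω < θ c) → |uA s ω - uB s ω| ≤ Δ s)
    (hgeom : ∀ s ∈ liveSmallW W live τ, nbhd s ⊆ liveSmall live τ) (haθ : ∀ c, a c ≤ θ c) :
    ∀ s ∈ liveSmallW W live τ, ∀ᵐ ω ∂(modelAWeightW γ W live uA a τ),
      (∀ c ∈ liveSmallW W live τ, uA c ω < a c) → |uA s ω - uB s ω| ≤ Δ s := by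
  refine condClose_of_domainClose _ nbhd hdet hgeom haθ ((ae_uvSmall_modelAW γ W live τ huA a).mono fun ω hω c hc hcW => ?_)
  simp only [liveSmall, Finset.mem_filter, Finset.mem_univ, true_and] at hc
  refine hω c hc.1 hc.2 fun hW => hcW ?_
  simp only [liveSmallW, Finset.mem_filter, Finset.mem_univ, true_and]
  exact ⟨hc, hW⟩

end JunctionW

/-! ## §3 the at-record twin of module 23b and the joint-space twin of module 23c with the CONDITIONAL closeness species (this seat) -/

section AtRecord

variable {F : T4Family} {G : Type*} [GaugeGroup G] [MeasurableSpace G] [HaarData G] [RegularGaugeGroup G]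
  (D : FiniteEpsData F G) (g₀ : ℕ → ℝ) (os : List (ULoop F)) (K₀ : ℕ)
  {Ω : ℕ → Type*} [∀ K, MeasurableSpace (Ω K)] {σ ι : Type*} [DecidableEq σ]
  {T : ℕ → Finset ι} {C : ℕ → Finset σ} {small : ℕ → ι → Finset σ} {lvl : ℕ → σ → ℕ}
  {νA νB : ∀ K : ℕ, (ℕ → ℝ) → ℝ → ι → Measure (Ω K)} [∀ K a t τ, IsFiniteMeasure (νA K a t τ)] [∀ K a t τ, IsFiniteMeasure (νB K a t τ)]
  {uA uB : ∀ K : ℕ, σ → Ω K → ℝ} {θ κ ρ Δ : ℕ → ℝ} {l₀ νbar : ℝ} {N₁ : ℕ} {κmin c₁ ϑ : ℝ}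

/-- **N21's ROAD I ON HISTORY FAMILIES RESUMMED AGAINST THE DRESSED LAWS OF RECORD, CLOSENESS ONLY ON THE OWN SMALL EVENT** — module 23b's
`shellWeightBound_histories_of_resummation_atRecord` with `hcloseX` CONDITIONAL (one call of §2 where 23b calls 20e; `γ0X := (Boltzmann law of D.scheme g₀ at step K₀+K ∕ K₀+K+1).map (eX K)`,
`γtX := (dressed law).map (eX K)`, `M := e^{l₀}` exactly as 23b instantiates them).  Displayed: (RESUM) against the NAMED laws, CONDITIONAL closeness, window, box, rate, `AvgMeasurable`,
the embeddings' measurability. [folklore] -/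
theorem shellWeightBound_histories_of_condCloseness_atRecord
    {eA : ∀ K : ℕ, GaugeField ((D.scheme g₀).P (K₀ + K)) 0 G → Ω K} {eB : ∀ K : ℕ, GaugeField ((D.scheme g₀).P (K₀ + K + 1)) 0 G → Ω K}
    (hM : D.AvgMeasurable) (heA : ∀ K, Measurable (eA K)) (heB : ∀ K, Measurable (eB K))
    (huA : ∀ K s, Measurable (uA K s)) (huB : ∀ K s, Measurable (uB K s))
    (hsmall : ∀ K, ∀ τ ∈ T K, small K τ ⊆ C K)
    (hθ : ∀ j, 0 < θ j) (hκ : ∀ j, 0 < κ j ∧ κ j ≤ 1) (hρ : ∀ j, 0 ≤ ρ j ∧ ρ j < 1)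
    (hwin : LiveWindow C lvl N₁ νbar)
    (hΔ : ∀ j, Δ j ≤ ρ j * ((1 - κ j) * θ j))
    (hcloseA : ∀ (K : ℕ) (a : ℕ → ℝ), (∀ j, a j ∈ Icc ((1 - κ j) * θ j) (θ j)) → ∀ t, |t| ≤ l₀ → ∀ τ ∈ T K, ∀ s ∈ small K τ,
      ∀ᵐ ω ∂(νA K a t τ), (∀ s' ∈ small K τ, uA K s' ω < a (lvl K s')) → |uA K s ω - uB K s ω| ≤ Δ (lvl K s))
    (hcloseB : ∀ (K : ℕ) (a : ℕ → ℝ), (∀ j, a j ∈ Icc ((1 - κ j) * θ j) (θ j)) → ∀ t, |t| ≤ l₀ → ∀ τ ∈ T K, ∀ s ∈ small K τ,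
      ∀ᵐ ω ∂(νB K a t τ), (∀ s' ∈ small K τ, uB K s' ω < a (lvl K s')) → |uB K s ω - uA K s ω| ≤ Δ (lvl K s))
    (hresA : ∀ (K : ℕ) (a : ℕ → ℝ), (∀ j, a j ∈ Icc ((1 - κ j) * θ j) (θ j)) → ∀ t, |t| ≤ l₀ →
      ∑ τ ∈ T K, histLaw (νA K a t τ) (small K τ) (uA K) (fun s => a (lvl K s)) =
        ((fieldMeasure ((D.scheme g₀).P (K₀ + K)) 0 G).withDensity (fun U => ENNReal.ofReal
          (Real.exp (t * prodObs (D.scheme g₀) (K₀ + K) os U) * boltzmann ((D.scheme g₀).P (K₀ + K)) ((D.scheme g₀).β (K₀ + K)) U))).map (eA K))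
    (hresB : ∀ (K : ℕ) (a : ℕ → ℝ), (∀ j, a j ∈ Icc ((1 - κ j) * θ j) (θ j)) → ∀ t, |t| ≤ l₀ →
      ∑ τ ∈ T K, histLaw (νB K a t τ) (small K τ) (uB K) (fun s => a (lvl K s)) =
        ((fieldMeasure ((D.scheme g₀).P (K₀ + K + 1)) 0 G).withDensity (fun U => ENNReal.ofReal
          (Real.exp (t * prodObs (D.scheme g₀) (K₀ + K + 1) os U) * boltzmann ((D.scheme g₀).P (K₀ + K + 1)) ((D.scheme g₀).β (K₀ + K + 1)) U))).map (eB K))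
    (hκmin : 0 < κmin) (hκminle : ∀ j, κmin ≤ κ j) (hρhalf : ∀ j, ρ j ≤ 1 / 2)
    (hϑ0 : 0 < ϑ) (hϑ1 : ϑ < 1) (hrate : ∀ j, ρ j ≤ c₁ * ϑ ^ j) :
    ∃ a : ℕ → ℕ → ℝ, (∀ K j, a K j ∈ Icc ((1 - κ j) * θ j) (θ j)) ∧
      ShellWeightBound l₀ T (fun K t τ => histWeight (νA K (a K) t τ) (small K τ) (uA K) (fun s => a K (lvl K s)))
        (fun K t τ => histWeight (νB K (a K) t τ) (small K τ) (uB K) (fun s => a K (lvl K s)))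
        (fun K t τ => histShell (νA K (a K) t τ) (small K τ) (uA K) (uB K) (fun s => a K (lvl K s)))
        (fun K t τ => histShell (νB K (a K) t τ) (small K τ) (uB K) (uA K) (fun s => a K (lvl K s)))
        fun K => (2 * ((N₁ + 1) * νbar * (Real.exp l₀ / (Real.exp l₀)⁻¹ * (2 * (2 * νbar) / κmin)) * c₁ * ϑ⁻¹ ^ N₁)) * ϑ ^ K := by
  have hβ : ∀ K, 0 ≤ (D.scheme g₀).β K := fun _ => sq_nonneg _
  have hm : ∀ K C, Measurable ((D.scheme g₀).obs K C) := fun K C => D.measurable_avgObs hM K C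
  have h1 : ∀ K C U, |(D.scheme g₀).obs K C U| ≤ 1 := fun K C U => D.abs_avgObs_le_one K C U
  haveI hfinA : ∀ K, IsFiniteMeasure (((fieldMeasure ((D.scheme g₀).P (K₀ + K)) 0 G).withDensity
      (fun U => ENNReal.ofReal (boltzmann ((D.scheme g₀).P (K₀ + K)) ((D.scheme g₀).β (K₀ + K)) U))).map (eA K)) := fun K => by
    haveI := isFiniteMeasure_boltzmannLaw (D.scheme g₀) (K₀ + K) hβ
    exact Measure.isFiniteMeasure_map _ _
  haveI hfinB : ∀ K, IsFiniteMeasure (((fieldMeasure ((D.scheme g₀).P (K₀ + K + 1)) 0 G).withDensity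
      (fun U => ENNReal.ofReal (boltzmann ((D.scheme g₀).P (K₀ + K + 1)) ((D.scheme g₀).β (K₀ + K + 1)) U))).map (eB K)) := fun K => by
    haveI := isFiniteMeasure_boltzmannLaw (D.scheme g₀) (K₀ + K + 1) hβ
    exact Measure.isFiniteMeasure_map _ _
  exact shellWeightBound_histories_of_condCloseness
    (γ0A := fun K => ((fieldMeasure ((D.scheme g₀).P (K₀ + K)) 0 G).withDensity
      (fun U => ENNReal.ofReal (boltzmann ((D.scheme g₀).P (K₀ + K)) ((D.scheme g₀).β (K₀ + K)) U))).map (eA K))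
    (γ0B := fun K => ((fieldMeasure ((D.scheme g₀).P (K₀ + K + 1)) 0 G).withDensity
      (fun U => ENNReal.ofReal (boltzmann ((D.scheme g₀).P (K₀ + K + 1)) ((D.scheme g₀).β (K₀ + K + 1)) U))).map (eB K))
    (γtA := fun K t => ((fieldMeasure ((D.scheme g₀).P (K₀ + K)) 0 G).withDensity (fun U => ENNReal.ofReal
      (Real.exp (t * prodObs (D.scheme g₀) (K₀ + K) os U) * boltzmann ((D.scheme g₀).P (K₀ + K)) ((D.scheme g₀).β (K₀ + K)) U))).map (eA K))
    (γtB := fun K t => ((fieldMeasure ((D.scheme g₀).P (K₀ + K + 1)) 0 G).withDensity (fun U => ENNReal.ofReal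
      (Real.exp (t * prodObs (D.scheme g₀) (K₀ + K + 1) os U) * boltzmann ((D.scheme g₀).P (K₀ + K + 1)) ((D.scheme g₀).β (K₀ + K + 1)) U))).map (eB K))
    (M := Real.exp l₀)
    huA huB hsmall hθ hκ hρ hwin (Real.exp_pos l₀) hΔ hcloseA hcloseB
    (fun K t ht => dressedLaw_sandwich_map (D.scheme g₀) (K₀ + K) os hm h1 ht (heA K))
    (fun K t ht => dressedLaw_sandwich_map (D.scheme g₀) (K₀ + K + 1) os hm h1 ht (heB K))
    hresA hresB hκmin hκminle hρhalf hϑ0 hϑ1 hrate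

/-- **THE SAME, JOINT-SPACE FORM** — module 23c's `shellWeightBound_histories_of_resummation_through` with `hcloseX` CONDITIONAL: ANY t-free finite laws `Γ0X` on NODE O's
common space, tilted through ANY measurable level-0 projections `πX K` by the source of record (`M := e^{l₀}`, `sourceTiltThrough_sandwich`). [folklore] -/
theorem shellWeightBound_histories_of_condCloseness_through
    {Γ0A Γ0B : ∀ K : ℕ, Measure (Ω K)} [∀ K, IsFiniteMeasure (Γ0A K)] [∀ K, IsFiniteMeasure (Γ0B K)]
    {πA : ∀ K : ℕ, Ω K → GaugeField ((D.scheme g₀).P (K₀ + K)) 0 G} {πB : ∀ K : ℕ, Ω K → GaugeField ((D.scheme g₀).P (K₀ + K + 1)) 0 G}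
    (hM : D.AvgMeasurable) (hπA : ∀ K, Measurable (πA K)) (hπB : ∀ K, Measurable (πB K))
    (huA : ∀ K s, Measurable (uA K s)) (huB : ∀ K s, Measurable (uB K s))
    (hsmall : ∀ K, ∀ τ ∈ T K, small K τ ⊆ C K)
    (hθ : ∀ j, 0 < θ j) (hκ : ∀ j, 0 < κ j ∧ κ j ≤ 1) (hρ : ∀ j, 0 ≤ ρ j ∧ ρ j < 1)
    (hwin : LiveWindow C lvl N₁ νbar)
    (hΔ : ∀ j, Δ j ≤ ρ j * ((1 - κ j) * θ j))
    (hcloseA : ∀ (K : ℕ) (a : ℕ → ℝ), (∀ j, a j ∈ Icc ((1 - κ j) * θ j) (θ j)) → ∀ t, |t| ≤ l₀ → ∀ τ ∈ T K, ∀ s ∈ small K τ,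
      ∀ᵐ ω ∂(νA K a t τ), (∀ s' ∈ small K τ, uA K s' ω < a (lvl K s')) → |uA K s ω - uB K s ω| ≤ Δ (lvl K s))
    (hcloseB : ∀ (K : ℕ) (a : ℕ → ℝ), (∀ j, a j ∈ Icc ((1 - κ j) * θ j) (θ j)) → ∀ t, |t| ≤ l₀ → ∀ τ ∈ T K, ∀ s ∈ small K τ,
      ∀ᵐ ω ∂(νB K a t τ), (∀ s' ∈ small K τ, uB K s' ω < a (lvl K s')) → |uB K s ω - uA K s ω| ≤ Δ (lvl K s))
    (hresA : ∀ (K : ℕ) (a : ℕ → ℝ), (∀ j, a j ∈ Icc ((1 - κ j) * θ j) (θ j)) → ∀ t, |t| ≤ l₀ →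
      ∑ τ ∈ T K, histLaw (νA K a t τ) (small K τ) (uA K) (fun s => a (lvl K s)) =
        (Γ0A K).withDensity (fun ω => ENNReal.ofReal (Real.exp (t * prodObs (D.scheme g₀) (K₀ + K) os (πA K ω)))))
    (hresB : ∀ (K : ℕ) (a : ℕ → ℝ), (∀ j, a j ∈ Icc ((1 - κ j) * θ j) (θ j)) → ∀ t, |t| ≤ l₀ →
      ∑ τ ∈ T K, histLaw (νB K a t τ) (small K τ) (uB K) (fun s => a (lvl K s)) =
        (Γ0B K).withDensity (fun ω => ENNReal.ofReal (Real.exp (t * prodObs (D.scheme g₀) (K₀ + K + 1) os (πB K ω)))))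
    (hκmin : 0 < κmin) (hκminle : ∀ j, κmin ≤ κ j) (hρhalf : ∀ j, ρ j ≤ 1 / 2)
    (hϑ0 : 0 < ϑ) (hϑ1 : ϑ < 1) (hrate : ∀ j, ρ j ≤ c₁ * ϑ ^ j) :
    ∃ a : ℕ → ℕ → ℝ, (∀ K j, a K j ∈ Icc ((1 - κ j) * θ j) (θ j)) ∧
      ShellWeightBound l₀ T (fun K t τ => histWeight (νA K (a K) t τ) (small K τ) (uA K) (fun s => a K (lvl K s)))
        (fun K t τ => histWeight (νB K (a K) t τ) (small K τ) (uB K) (fun s => a K (lvl K s)))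
        (fun K t τ => histShell (νA K (a K) t τ) (small K τ) (uA K) (uB K) (fun s => a K (lvl K s)))
        (fun K t τ => histShell (νB K (a K) t τ) (small K τ) (uB K) (uA K) (fun s => a K (lvl K s)))
        fun K => (2 * ((N₁ + 1) * νbar * (Real.exp l₀ / (Real.exp l₀)⁻¹ * (2 * (2 * νbar) / κmin)) * c₁ * ϑ⁻¹ ^ N₁)) * ϑ ^ K := by
  have hm : ∀ K C, Measurable ((D.scheme g₀).obs K C) := fun K C => D.measurable_avgObs hM K C
  have h1 : ∀ K C U, |(D.scheme g₀).obs K C U| ≤ 1 := fun K C U => D.abs_avgObs_le_one K C U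
  exact shellWeightBound_histories_of_condCloseness
    (γtA := fun K t => (Γ0A K).withDensity (fun ω => ENNReal.ofReal (Real.exp (t * prodObs (D.scheme g₀) (K₀ + K) os (πA K ω)))))
    (γtB := fun K t => (Γ0B K).withDensity (fun ω => ENNReal.ofReal (Real.exp (t * prodObs (D.scheme g₀) (K₀ + K + 1) os (πB K ω)))))
    (M := Real.exp l₀)
    huA huB hsmall hθ hκ hρ hwin (Real.exp_pos l₀) hΔ hcloseA hcloseB
    (fun K t ht => sourceTiltThrough_sandwich (D.scheme g₀) (K₀ + K) os hm h1 (Γ0A K) (hπA K) ht)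
    (fun K t ht => sourceTiltThrough_sandwich (D.scheme g₀) (K₀ + K + 1) os hm h1 (Γ0B K) (hπB K) ht)
    hresA hresB hκmin hκminle hρhalf hϑ0 hϑ1 hrate

end AtRecord

end Summit.QuantumFields.YangMills.Theorems.N21HistoriesConditionalCloseness

end
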